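import Summits.NavierStokesRegularity.NavierStokesRegularity.Theorems.SqueezeCycleNoApexTypeIProfileEnvelopeSlices
import Literature.Analysis.FluidPDE.LocalTypeIWeakSerrinProofs
import HarnessLib

/-!
# Route SqueezeCycle · item `NoApexTypeIProfile` (stmt-NavierStokesRegularity-11716):
# scale-invariant envelopes imply Albritton–Barker's `𝐈(ℝ³ × ℝ₋) < ∞` — part 2, the four quantities

Helper file (theorems only; no definitions, no named facts), `--supports` the item.

Write `w(t,x) = ‖x‖ + √(−t)`.  If a velocity field `V`, a pressure `Q` and a gradient field `G` on
the open backward slab `(−∞,0) × ℝ³` obey the SCALE-INVARIANT ENVELOPES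

* `‖V(t,x)‖ ≤ C / w` (the apex Type-I bound `HasTypeIDecay C V`, KNSS 2009 (1.6)),
* `‖G(t,x)‖ ≤ L / w²`, `|Q(t,x)| ≤ L / w²`

(the regularity package of smooth apex profiles, Seregin–Šverák 2009 §2 / the tree's
`ScaleInvariantBounds`), then all four Albritton–Barker quantities are bounded on EVERY parabolic
ball `Q(z,r)` of the slab, uniformly in `z` and `r`: `A ≤ C² M₂`, `C ≤ 2 C³ M₂`,
`D ≤ 4 · 2 L^{3/2} M₂` (`D_osc ≤ 4 D`), `E ≤ 12 L² M_{5/2}` — the slice integrals of part 1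
(`SqueezeCycleNoApexTypeIProfileEnvelopeSlices.lean`) integrated in time by Tonelli, the powers of
`r` cancelling exactly against the scaling weights `r⁻¹, r⁻², r⁻², r⁻¹`.  Hence
`typeIBound (Iio 0 ×ˢ univ) V Q G < ⊤` (`typeIBound_slab_lt_top_of_envelopes`).

Used by `SqueezeCycleNoApexTypeIProfileTypeIBoundIdle.lean` (part 3): the hypothesis `𝐈 < ∞` of the
item is idle — an apex profile always has a representative with `𝐈 < ∞`.

## References

* D. Albritton, T. Barker, *On local Type I singularities of the Navier–Stokes equations and
  Liouville theorems*, J. Math. Fluid Mech. 21 (2019) = arXiv:1811.00502, §1. [AlbrittonBarker2019]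
* G. Koch, N. Nadirashvili, G. Seregin, V. Šverák, Acta Math. 203 (2009), (1.6). [KNSS2009]
* G. Seregin, V. Šverák, Comm. PDE 34 (2009) = arXiv:0804.1803, §2. [SereginSverak2009]
-/

noncomputable section

-- the sub-problem namespace repeats the summit name (D-0017 layout `Summit.<S>.<P>.Theorems`)
set_option linter.dupNamespace false

namespace Summit.NavierStokesRegularity.NavierStokesRegularity.Theorems.NoApexEnvelope

open MeasureTheory Set Function Filter Metric TopologicalSpace
open scoped ENNReal NNReal Topology
open Literature.Analysis.FluidPDE
open Literature.Analysis.FluidPDE.ParabolicBump (neg_of_mem_time fst_nonpos_of_subset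
  lintegral_cylinder_le_of_slice)

variable {V : ℝ → (EuclideanSpace ℝ (Fin 3)) → (EuclideanSpace ℝ (Fin 3))} {Q : ℝ → (EuclideanSpace ℝ (Fin 3)) → ℝ} {G : ℝ → (EuclideanSpace ℝ (Fin 3)) → (EuclideanSpace ℝ (Fin 3)) →L[ℝ] (EuclideanSpace ℝ (Fin 3))} {C L : ℝ}

/-! ### Slice integrals over balls -/

variable {M : ℝ}

/-- **Slice energy**: `∫_{B(x₀,r)} |V(t)|² ≤ C² M₂ r`. [folklore] -/
theorem lintegral_ball_sq_le (hV : HasTypeIDecay C V)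
    (hM : ∀ (x₀ : (EuclideanSpace ℝ (Fin 3))) (r : ℝ), 0 < r →
      ∫⁻ x in ball x₀ r, ENNReal.ofReal (‖x‖ ^ (-(2 : ℝ))) ≤ ENNReal.ofReal (M * r))
    {t : ℝ} (ht : t < 0) (x₀ : (EuclideanSpace ℝ (Fin 3))) {r : ℝ} (hr : 0 < r) :
    ∫⁻ x in ball x₀ r, ‖V t x‖ₑ ^ 2 ≤ ENNReal.ofReal (C ^ 2 * (M * r)) := by
  calc ∫⁻ x in ball x₀ r, ‖V t x‖ₑ ^ 2
      ≤ ∫⁻ x in ball x₀ r, ENNReal.ofReal (C ^ 2) * ENNReal.ofReal (‖x‖ ^ (-(2 : ℝ))) :=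
        lintegral_mono_ae ((ae_ne_zero_ball x₀ r).mono fun x hx => enorm_sq_le_of_envelope hV ht hx)
    _ = ENNReal.ofReal (C ^ 2) * ∫⁻ x in ball x₀ r, ENNReal.ofReal (‖x‖ ^ (-(2 : ℝ))) :=
        lintegral_const_mul' _ _ ENNReal.ofReal_ne_top
    _ ≤ ENNReal.ofReal (C ^ 2) * ENNReal.ofReal (M * r) := mul_le_mul' le_rfl (hM x₀ r hr)
    _ = _ := by rw [← ENNReal.ofReal_mul (sq_nonneg C)]

/-- **Slice cubic quantity**: `∫_{B(x₀,r)} |V(t)|³ ≤ C³ (−t)^{−1/2} M₂ r`. [folklore] -/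
theorem lintegral_ball_cube_le (hV : HasTypeIDecay C V)
    (hM : ∀ (x₀ : (EuclideanSpace ℝ (Fin 3))) (r : ℝ), 0 < r →
      ∫⁻ x in ball x₀ r, ENNReal.ofReal (‖x‖ ^ (-(2 : ℝ))) ≤ ENNReal.ofReal (M * r))
    (hM0 : 0 ≤ M) {t : ℝ} (ht : t < 0) (x₀ : (EuclideanSpace ℝ (Fin 3))) {r : ℝ} (hr : 0 < r) :
    ∫⁻ x in ball x₀ r, ‖V t x‖ₑ ^ (3 : ℕ) ≤
      ENNReal.ofReal (C ^ 3 * (M * r)) * ENNReal.ofReal ((-t) ^ (-(1 / 2 : ℝ))) := by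
  have hC : 0 ≤ C := nonneg_of_hasTypeIDecay hV
  have ht0 : 0 < -t := by linarith
  have ht' : 0 ≤ (-t) ^ (-(1 / 2 : ℝ)) := Real.rpow_nonneg (by linarith) _
  calc ∫⁻ x in ball x₀ r, ‖V t x‖ₑ ^ (3 : ℕ)
      ≤ ∫⁻ x in ball x₀ r, ENNReal.ofReal (C ^ 3 * (-t) ^ (-(1 / 2 : ℝ))) *
          ENNReal.ofReal (‖x‖ ^ (-(2 : ℝ))) :=
        lintegral_mono_ae ((ae_ne_zero_ball x₀ r).mono fun x hx => enorm_cube_le_of_envelope hV ht hx)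
    _ = ENNReal.ofReal (C ^ 3 * (-t) ^ (-(1 / 2 : ℝ))) *
          ∫⁻ x in ball x₀ r, ENNReal.ofReal (‖x‖ ^ (-(2 : ℝ))) :=
        lintegral_const_mul' _ _ ENNReal.ofReal_ne_top
    _ ≤ ENNReal.ofReal (C ^ 3 * (-t) ^ (-(1 / 2 : ℝ))) * ENNReal.ofReal (M * r) :=
        mul_le_mul' le_rfl (hM x₀ r hr)
    _ = _ := by
        rw [← ENNReal.ofReal_mul (by positivity), ← ENNReal.ofReal_mul (by positivity)]
        ring_nf

/-- **Slice pressure quantity**: `∫_{B(x₀,r)} |Q(t)|^{3/2} ≤ L^{3/2} (−t)^{−1/2} M₂ r`. [folklore] -/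
theorem lintegral_ball_pressure_le
    (hQ : ∀ t < 0, ∀ x, |Q t x| ≤ L / (‖x‖ + Real.sqrt (-t)) ^ 2) (hL : 0 ≤ L)
    (hM : ∀ (x₀ : (EuclideanSpace ℝ (Fin 3))) (r : ℝ), 0 < r →
      ∫⁻ x in ball x₀ r, ENNReal.ofReal (‖x‖ ^ (-(2 : ℝ))) ≤ ENNReal.ofReal (M * r))
    (hM0 : 0 ≤ M) {t : ℝ} (ht : t < 0) (x₀ : (EuclideanSpace ℝ (Fin 3))) {r : ℝ} (hr : 0 < r) :
    ∫⁻ x in ball x₀ r, ‖Q t x‖ₑ ^ (3 / 2 : ℝ) ≤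
      ENNReal.ofReal (L ^ (3 / 2 : ℝ) * (M * r)) * ENNReal.ofReal ((-t) ^ (-(1 / 2 : ℝ))) := by
  have ht0 : 0 < -t := by linarith
  have hL' : 0 ≤ L ^ (3 / 2 : ℝ) := Real.rpow_nonneg hL _
  have ht' : 0 ≤ (-t) ^ (-(1 / 2 : ℝ)) := Real.rpow_nonneg (by linarith) _
  calc ∫⁻ x in ball x₀ r, ‖Q t x‖ₑ ^ (3 / 2 : ℝ)
      ≤ ∫⁻ x in ball x₀ r, ENNReal.ofReal (L ^ (3 / 2 : ℝ) * (-t) ^ (-(1 / 2 : ℝ))) *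
          ENNReal.ofReal (‖x‖ ^ (-(2 : ℝ))) :=
        lintegral_mono_ae ((ae_ne_zero_ball x₀ r).mono fun x hx =>
          enorm_rpow_le_of_envelope hQ hL ht hx)
    _ = ENNReal.ofReal (L ^ (3 / 2 : ℝ) * (-t) ^ (-(1 / 2 : ℝ))) *
          ∫⁻ x in ball x₀ r, ENNReal.ofReal (‖x‖ ^ (-(2 : ℝ))) :=
        lintegral_const_mul' _ _ ENNReal.ofReal_ne_top
    _ ≤ ENNReal.ofReal (L ^ (3 / 2 : ℝ) * (-t) ^ (-(1 / 2 : ℝ))) * ENNReal.ofReal (M * r) :=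
        mul_le_mul' le_rfl (hM x₀ r hr)
    _ = _ := by
        rw [← ENNReal.ofReal_mul (by positivity), ← ENNReal.ofReal_mul (by positivity)]
        ring_nf

/-- **Slice dissipation**: `∫_{B(x₀,r)} |G(t)|²_F ≤ 3 L² (−t)^{−3/4} M_{5/2} r^{1/2}`. [folklore] -/
theorem lintegral_ball_frob_le
    (hG : ∀ t < 0, ∀ x, ‖G t x‖ ≤ L / (‖x‖ + Real.sqrt (-t)) ^ 2)
    (hM : ∀ (x₀ : (EuclideanSpace ℝ (Fin 3))) (r : ℝ), 0 < r →
      ∫⁻ x in ball x₀ r, ENNReal.ofReal (‖x‖ ^ (-(5 / 2 : ℝ))) ≤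
        ENNReal.ofReal (M * r ^ (1 / 2 : ℝ)))
    (hM0 : 0 ≤ M) {t : ℝ} (ht : t < 0) (x₀ : (EuclideanSpace ℝ (Fin 3))) {r : ℝ} (hr : 0 < r) :
    ∫⁻ x in ball x₀ r, ENNReal.ofReal (frobeniusNormSq (G t x)) ≤
      ENNReal.ofReal (3 * L ^ 2 * (M * r ^ (1 / 2 : ℝ))) *
        ENNReal.ofReal ((-t) ^ (-(3 / 4 : ℝ))) := by
  have ht0 : 0 < -t := by linarith
  have ht' : 0 ≤ (-t) ^ (-(3 / 4 : ℝ)) := Real.rpow_nonneg (by linarith) _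
  calc ∫⁻ x in ball x₀ r, ENNReal.ofReal (frobeniusNormSq (G t x))
      ≤ ∫⁻ x in ball x₀ r, ENNReal.ofReal (3 * L ^ 2 * (-t) ^ (-(3 / 4 : ℝ))) *
          ENNReal.ofReal (‖x‖ ^ (-(5 / 2 : ℝ))) :=
        lintegral_mono_ae ((ae_ne_zero_ball x₀ r).mono fun x hx =>
          ofReal_frob_le_of_envelope hG ht hx)
    _ = ENNReal.ofReal (3 * L ^ 2 * (-t) ^ (-(3 / 4 : ℝ))) *
          ∫⁻ x in ball x₀ r, ENNReal.ofReal (‖x‖ ^ (-(5 / 2 : ℝ))) :=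
        lintegral_const_mul' _ _ ENNReal.ofReal_ne_top
    _ ≤ ENNReal.ofReal (3 * L ^ 2 * (-t) ^ (-(3 / 4 : ℝ))) *
          ENNReal.ofReal (M * r ^ (1 / 2 : ℝ)) := mul_le_mul' le_rfl (hM x₀ r hr)
    _ = _ := by
        rw [← ENNReal.ofReal_mul (by positivity), ← ENNReal.ofReal_mul (by positivity)]
        ring_nf


/-! ### The four Albritton–Barker quantities on admissible cylinders -/

section Cylinders

variable {r : ℝ} {z : ℝ × (EuclideanSpace ℝ (Fin 3))}

/-- `(ofReal r)⁻¹ · ofReal (K r) = ofReal K` for `r > 0`. [folklore] -/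
theorem ofReal_inv_mul_ofReal_mul (hr : 0 < r) (K : ℝ) :
    (ENNReal.ofReal r)⁻¹ * ENNReal.ofReal (K * r) = ENNReal.ofReal K := by
  rw [← ENNReal.ofReal_inv_of_pos hr, ← ENNReal.ofReal_mul (inv_nonneg.2 hr.le)]
  congr 1
  field_simp

/-- `(ofReal r ^ 2)⁻¹ · (ofReal (K r) · ofReal (2 r)) = ofReal (2 K)` for `r > 0`, `K ≥ 0`. [folklore] -/
theorem ofReal_sq_inv_mul (hr : 0 < r) {K : ℝ} (hK : 0 ≤ K) :
    (ENNReal.ofReal r ^ 2)⁻¹ * (ENNReal.ofReal (K * r) * ENNReal.ofReal (2 * r)) =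
      ENNReal.ofReal (2 * K) := by
  rw [← ENNReal.ofReal_pow hr.le, ← ENNReal.ofReal_inv_of_pos (by positivity),
    ← ENNReal.ofReal_mul (by positivity : (0 : ℝ) ≤ K * r),
    ← ENNReal.ofReal_mul (inv_nonneg.2 (by positivity))]
  congr 1
  field_simp

/-- **`A(Q(z,r)) ≤ C² M₂`** on every admissible cylinder. [cite: AlbrittonBarker2019, §1] -/
theorem cknAEss_le_of_envelope (hV : HasTypeIDecay C V)
    (hM : ∀ (x₀ : (EuclideanSpace ℝ (Fin 3))) (r : ℝ), 0 < r →
      ∫⁻ x in ball x₀ r, ENNReal.ofReal (‖x‖ ^ (-(2 : ℝ))) ≤ ENNReal.ofReal (M * r))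
    (hr : 0 < r) (hz : parabolicCylinder r z ⊆ Iio (0 : ℝ) ×ˢ (univ : Set (EuclideanSpace ℝ (Fin 3)))) :
    cknAEss r z V ≤ ENNReal.ofReal (C ^ 2 * M) := by
  unfold cknAEss
  refine essSup_le_of_ae_le _ ?_
  filter_upwards [ae_restrict_mem measurableSet_Ioo] with t ht
  have ht0 : t < 0 := neg_of_mem_time hr hz ht
  calc (ENNReal.ofReal r)⁻¹ * ∫⁻ x in ball z.2 r, ‖V t x‖ₑ ^ 2
      ≤ (ENNReal.ofReal r)⁻¹ * ENNReal.ofReal (C ^ 2 * (M * r)) :=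
        mul_le_mul' le_rfl (lintegral_ball_sq_le hV hM ht0 z.2 hr)
    _ = ENNReal.ofReal (C ^ 2 * M) := by
        rw [show C ^ 2 * (M * r) = C ^ 2 * M * r by ring]
        exact ofReal_inv_mul_ofReal_mul hr _

/-- **`C(Q(z,r)) ≤ 2 C³ M₂`** on every admissible cylinder. [cite: AlbrittonBarker2019, §1] -/
theorem cknC_le_of_envelope (hV : HasTypeIDecay C V)
    (hVm : AEMeasurable (uncurry V) (volume.restrict (Iio (0 : ℝ) ×ˢ (univ : Set (EuclideanSpace ℝ (Fin 3))))))
    (hM : ∀ (x₀ : (EuclideanSpace ℝ (Fin 3))) (r : ℝ), 0 < r →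
      ∫⁻ x in ball x₀ r, ENNReal.ofReal (‖x‖ ^ (-(2 : ℝ))) ≤ ENNReal.ofReal (M * r))
    (hM0 : 0 ≤ M) (hr : 0 < r) (hz : parabolicCylinder r z ⊆ Iio (0 : ℝ) ×ˢ (univ : Set (EuclideanSpace ℝ (Fin 3)))) :
    cknC r z V ≤ ENNReal.ofReal (2 * (C ^ 3 * M)) := by
  have hC : 0 ≤ C := nonneg_of_hasTypeIDecay hV
  have hz1 : z.1 ≤ 0 := fst_nonpos_of_subset hr hz
  unfold cknC
  have hmeas : AEMeasurable (fun q : ℝ × (EuclideanSpace ℝ (Fin 3)) => ‖V q.1 q.2‖ₑ ^ (3 : ℕ))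
      (volume.restrict (parabolicCylinder r z)) :=
    (hVm.mono_measure (Measure.restrict_mono hz le_rfl)).enorm.pow_const _
  have h1 : ∫⁻ q in parabolicCylinder r z, ‖V q.1 q.2‖ₑ ^ (3 : ℕ) ≤
      ∫⁻ t in Ioo (z.1 - r ^ 2) z.1,
        ENNReal.ofReal (C ^ 3 * (M * r)) * ENNReal.ofReal ((-t) ^ (-(1 / 2 : ℝ))) :=
    lintegral_cylinder_le_of_slice hmeas (by
      filter_upwards [ae_restrict_mem measurableSet_Ioo] with t ht
      exact lintegral_ball_cube_le hV hM hM0 (neg_of_mem_time hr hz ht) z.2 hr)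
  have h2 : ∫⁻ t in Ioo (z.1 - r ^ 2) z.1,
        ENNReal.ofReal (C ^ 3 * (M * r)) * ENNReal.ofReal ((-t) ^ (-(1 / 2 : ℝ))) ≤
      ENNReal.ofReal (C ^ 3 * (M * r)) * ENNReal.ofReal (2 * r) := by
    rw [lintegral_const_mul' _ _ ENNReal.ofReal_ne_top]
    refine mul_le_mul' le_rfl ((lintegral_time_rpow_neg_le (by norm_num) (by norm_num) hz1 hr).trans
      (le_of_eq ?_))
    congr 1
    norm_num
    ring
  calc (ENNReal.ofReal r ^ 2)⁻¹ * ∫⁻ q in parabolicCylinder r z, ‖V q.1 q.2‖ₑ ^ (3 : ℕ)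
      ≤ (ENNReal.ofReal r ^ 2)⁻¹ * (ENNReal.ofReal (C ^ 3 * (M * r)) * ENNReal.ofReal (2 * r)) :=
        mul_le_mul' le_rfl (h1.trans h2)
    _ = ENNReal.ofReal (2 * (C ^ 3 * M)) := by
        rw [show C ^ 3 * (M * r) = C ^ 3 * M * r by ring]
        exact ofReal_sq_inv_mul hr (by positivity)

/-- **`D(Q(z,r)) ≤ 4 · 2 L^{3/2} M₂`** on every admissible cylinder (`D_osc ≤ 4 D`,
`cknDOsc_le_four_mul_cknD`). [cite: AlbrittonBarker2019, §1] -/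
theorem cknDOsc_le_of_envelope
    (hQ : ∀ t < 0, ∀ x, |Q t x| ≤ L / (‖x‖ + Real.sqrt (-t)) ^ 2) (hL : 0 ≤ L)
    (hQm : AEStronglyMeasurable (uncurry Q) (volume.restrict (Iio (0 : ℝ) ×ˢ (univ : Set (EuclideanSpace ℝ (Fin 3))))))
    (hM : ∀ (x₀ : (EuclideanSpace ℝ (Fin 3))) (r : ℝ), 0 < r →
      ∫⁻ x in ball x₀ r, ENNReal.ofReal (‖x‖ ^ (-(2 : ℝ))) ≤ ENNReal.ofReal (M * r))
    (hM0 : 0 ≤ M) (hr : 0 < r) (hz : parabolicCylinder r z ⊆ Iio (0 : ℝ) ×ˢ (univ : Set (EuclideanSpace ℝ (Fin 3)))) :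
    cknDOsc r z Q ≤ 4 * ENNReal.ofReal (2 * (L ^ (3 / 2 : ℝ) * M)) := by
  have hz1 : z.1 ≤ 0 := fst_nonpos_of_subset hr hz
  have hQm' : AEStronglyMeasurable (uncurry Q) (volume.restrict (parabolicCylinder r z)) :=
    hQm.mono_measure (Measure.restrict_mono hz le_rfl)
  refine (AlbrittonBarker2019.cknDOsc_le_four_mul_cknD hr hQm').trans (mul_le_mul' le_rfl ?_)
  unfold cknD
  have hmeas : AEMeasurable (fun q : ℝ × (EuclideanSpace ℝ (Fin 3)) => ‖Q q.1 q.2‖ₑ ^ (3 / 2 : ℝ))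
      (volume.restrict (parabolicCylinder r z)) :=
    hQm'.aemeasurable.enorm.pow_const _
  have h1 : ∫⁻ q in parabolicCylinder r z, ‖Q q.1 q.2‖ₑ ^ (3 / 2 : ℝ) ≤
      ∫⁻ t in Ioo (z.1 - r ^ 2) z.1,
        ENNReal.ofReal (L ^ (3 / 2 : ℝ) * (M * r)) * ENNReal.ofReal ((-t) ^ (-(1 / 2 : ℝ))) :=
    lintegral_cylinder_le_of_slice hmeas (by
      filter_upwards [ae_restrict_mem measurableSet_Ioo] with t ht
      exact lintegral_ball_pressure_le hQ hL hM hM0 (neg_of_mem_time hr hz ht) z.2 hr)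
  have h2 : ∫⁻ t in Ioo (z.1 - r ^ 2) z.1,
        ENNReal.ofReal (L ^ (3 / 2 : ℝ) * (M * r)) * ENNReal.ofReal ((-t) ^ (-(1 / 2 : ℝ))) ≤
      ENNReal.ofReal (L ^ (3 / 2 : ℝ) * (M * r)) * ENNReal.ofReal (2 * r) := by
    rw [lintegral_const_mul' _ _ ENNReal.ofReal_ne_top]
    refine mul_le_mul' le_rfl ((lintegral_time_rpow_neg_le (by norm_num) (by norm_num) hz1 hr).trans
      (le_of_eq ?_))
    congr 1
    norm_num
    ring
  have hL' : 0 ≤ L ^ (3 / 2 : ℝ) := Real.rpow_nonneg hL _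
  calc (ENNReal.ofReal r ^ 2)⁻¹ * ∫⁻ q in parabolicCylinder r z, ‖Q q.1 q.2‖ₑ ^ (3 / 2 : ℝ)
      ≤ (ENNReal.ofReal r ^ 2)⁻¹ *
          (ENNReal.ofReal (L ^ (3 / 2 : ℝ) * (M * r)) * ENNReal.ofReal (2 * r)) :=
        mul_le_mul' le_rfl (h1.trans h2)
    _ = ENNReal.ofReal (2 * (L ^ (3 / 2 : ℝ) * M)) := by
        rw [show L ^ (3 / 2 : ℝ) * (M * r) = L ^ (3 / 2 : ℝ) * M * r by ring]
        exact ofReal_sq_inv_mul hr (by positivity)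

/-- **`E(Q(z,r)) ≤ 12 L² M_{5/2}`** on every admissible cylinder. [cite: AlbrittonBarker2019, §1] -/
theorem cknE_le_of_envelope
    (hG : ∀ t < 0, ∀ x, ‖G t x‖ ≤ L / (‖x‖ + Real.sqrt (-t)) ^ 2)
    (hGm : AEMeasurable (fun q : ℝ × (EuclideanSpace ℝ (Fin 3)) => ENNReal.ofReal (frobeniusNormSq (G q.1 q.2)))
      (volume.restrict (Iio (0 : ℝ) ×ˢ (univ : Set (EuclideanSpace ℝ (Fin 3))))))
    {M' : ℝ} (hM : ∀ (x₀ : (EuclideanSpace ℝ (Fin 3))) (r : ℝ), 0 < r →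
      ∫⁻ x in ball x₀ r, ENNReal.ofReal (‖x‖ ^ (-(5 / 2 : ℝ))) ≤
        ENNReal.ofReal (M' * r ^ (1 / 2 : ℝ)))
    (hM0 : 0 ≤ M') (hr : 0 < r) (hz : parabolicCylinder r z ⊆ Iio (0 : ℝ) ×ˢ (univ : Set (EuclideanSpace ℝ (Fin 3)))) :
    cknE r z G ≤ ENNReal.ofReal (12 * (L ^ 2 * M')) := by
  have hz1 : z.1 ≤ 0 := fst_nonpos_of_subset hr hz
  unfold cknE
  have hmeas : AEMeasurable (fun q : ℝ × (EuclideanSpace ℝ (Fin 3)) => ENNReal.ofReal (frobeniusNormSq (G q.1 q.2)))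
      (volume.restrict (parabolicCylinder r z)) :=
    hGm.mono_measure (Measure.restrict_mono hz le_rfl)
  have h1 : ∫⁻ q in parabolicCylinder r z, ENNReal.ofReal (frobeniusNormSq (G q.1 q.2)) ≤
      ∫⁻ t in Ioo (z.1 - r ^ 2) z.1,
        ENNReal.ofReal (3 * L ^ 2 * (M' * r ^ (1 / 2 : ℝ))) *
          ENNReal.ofReal ((-t) ^ (-(3 / 4 : ℝ))) :=
    lintegral_cylinder_le_of_slice hmeas (by
      filter_upwards [ae_restrict_mem measurableSet_Ioo] with t ht
      exact lintegral_ball_frob_le hG hM hM0 (neg_of_mem_time hr hz ht) z.2 hr)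
  have h2 : ∫⁻ t in Ioo (z.1 - r ^ 2) z.1,
        ENNReal.ofReal (3 * L ^ 2 * (M' * r ^ (1 / 2 : ℝ))) *
          ENNReal.ofReal ((-t) ^ (-(3 / 4 : ℝ))) ≤
      ENNReal.ofReal (3 * L ^ 2 * (M' * r ^ (1 / 2 : ℝ))) * ENNReal.ofReal (4 * r ^ (1 / 2 : ℝ)) := by
    rw [lintegral_const_mul' _ _ ENNReal.ofReal_ne_top]
    refine mul_le_mul' le_rfl ((lintegral_time_rpow_neg_le (by norm_num) (by norm_num) hz1 hr).trans
      (le_of_eq ?_))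
    congr 1
    norm_num
    ring
  have hrr : r ^ (1 / 2 : ℝ) * r ^ (1 / 2 : ℝ) = r := by
    rw [← Real.rpow_add hr]; norm_num
  have hr2 : 0 ≤ r ^ (1 / 2 : ℝ) := Real.rpow_nonneg hr.le _
  calc (ENNReal.ofReal r)⁻¹ *
        ∫⁻ q in parabolicCylinder r z, ENNReal.ofReal (frobeniusNormSq (G q.1 q.2))
      ≤ (ENNReal.ofReal r)⁻¹ * (ENNReal.ofReal (3 * L ^ 2 * (M' * r ^ (1 / 2 : ℝ))) *
          ENNReal.ofReal (4 * r ^ (1 / 2 : ℝ))) := mul_le_mul' le_rfl (h1.trans h2)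
    _ = ENNReal.ofReal (12 * (L ^ 2 * M')) := by
        rw [← ENNReal.ofReal_mul (by positivity),
          show 3 * L ^ 2 * (M' * r ^ (1 / 2 : ℝ)) * (4 * r ^ (1 / 2 : ℝ)) =
            12 * (L ^ 2 * M') * (r ^ (1 / 2 : ℝ) * r ^ (1 / 2 : ℝ)) by ring, hrr]
        exact ofReal_inv_mul_ofReal_mul hr _

end Cylinders

/-! ### `𝐈(ℝ³ × ℝ₋) < ∞` from the envelopes -/

/-- **Scale-invariant envelopes imply `𝐈 < ∞`.**  If `‖V(t,x)‖ ≤ C/(‖x‖+√(−t))` (the apex Type-I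
bound), `‖G(t,x)‖ ≤ L/(‖x‖+√(−t))²` and `|Q(t,x)| ≤ L/(‖x‖+√(−t))²` on the open backward slab
(plus the obvious measurability), then Albritton–Barker's Type-I quantity of `(V, Q, G)` on
`ℝ³ × ℝ₋` is finite: `𝐈 ≤ C² M₂ + 2 C³ M₂ + 8 L^{3/2} M₂ + 12 L² M_{5/2}`.
[cite: AlbrittonBarker2019, §1 (definition of 𝐈(ω))] -/
theorem typeIBound_slab_lt_top_of_envelopes
    (hVm : AEMeasurable (uncurry V) (volume.restrict (Iio (0 : ℝ) ×ˢ (univ : Set (EuclideanSpace ℝ (Fin 3))))))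
    (hQm : AEStronglyMeasurable (uncurry Q) (volume.restrict (Iio (0 : ℝ) ×ˢ (univ : Set (EuclideanSpace ℝ (Fin 3))))))
    (hGm : AEMeasurable (fun q : ℝ × (EuclideanSpace ℝ (Fin 3)) => ENNReal.ofReal (frobeniusNormSq (G q.1 q.2)))
      (volume.restrict (Iio (0 : ℝ) ×ˢ (univ : Set (EuclideanSpace ℝ (Fin 3))))))
    (hV : HasTypeIDecay C V)
    (hG : ∀ t < 0, ∀ x, ‖G t x‖ ≤ L / (‖x‖ + Real.sqrt (-t)) ^ 2)
    (hQ : ∀ t < 0, ∀ x, |Q t x| ≤ L / (‖x‖ + Real.sqrt (-t)) ^ 2) :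
    typeIBound (Iio (0 : ℝ) ×ˢ univ) V Q G < ⊤ := by
  have hL : 0 ≤ L := by
    have h := hQ (-1) (by norm_num) 0
    rw [norm_zero, neg_neg, Real.sqrt_one, zero_add, one_pow, div_one] at h
    exact (abs_nonneg _).trans h
  obtain ⟨M, hM0, hM⟩ := exists_ball_rpow_two_bound
  obtain ⟨M', hM0', hM'⟩ := exists_ball_rpow_fiveHalves_bound
  have hbound : typeIBound (Iio (0 : ℝ) ×ˢ univ) V Q G ≤
      ENNReal.ofReal (C ^ 2 * M) + ENNReal.ofReal (2 * (C ^ 3 * M)) +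
        4 * ENNReal.ofReal (2 * (L ^ (3 / 2 : ℝ) * M)) + ENNReal.ofReal (12 * (L ^ 2 * M')) := by
    refine typeIBound_le_iff.2 fun r hr z hz => ?_
    unfold abScaledSum
    exact add_le_add (add_le_add (add_le_add (cknAEss_le_of_envelope hV hM hr hz)
      (cknC_le_of_envelope hV hVm hM hM0 hr hz)) (cknDOsc_le_of_envelope hQ hL hQm hM hM0 hr hz))
      (cknE_le_of_envelope hG hGm hM' hM0' hr hz)
  refine lt_of_le_of_lt hbound ?_
  have h4 : (4 : ℝ≥0∞) * ENNReal.ofReal (2 * (L ^ (3 / 2 : ℝ) * M)) < ⊤ :=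
    ENNReal.mul_lt_top (by simp) ENNReal.ofReal_lt_top
  exact ENNReal.add_lt_top.2 ⟨ENNReal.add_lt_top.2 ⟨ENNReal.add_lt_top.2
    ⟨ENNReal.ofReal_lt_top, ENNReal.ofReal_lt_top⟩, h4⟩, ENNReal.ofReal_lt_top⟩

end Summit.NavierStokesRegularity.NavierStokesRegularity.Theorems.NoApexEnvelope

end
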